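import Mathlib
import HarnessLib
import HarnessLib.Audit
import Summits.ABC.Statement
import Literature.NumberTheory.EllipticCurves.PastenValuationProduct
import Literature.NumberTheory.DiophantineGeometry.LocalReduction
import Summits.ABC.ABC.Theorems.PlacewiseSzpiroSingleTowerSzpiroMersenneRadicalRungs
import HarnessLib.Audit.Status.Attr

/-!
Route: TamagawaTwistDictionary

# Route TamagawaTwistDictionary — Small Tamagawa products plus the twist dictionary give
sub-exponential Szpiro

D-0145 ideator LINE (abc-idea-1 g3, technique card «dictionary import with an explicit checkable
dictionary»). NO SUMMIT IS PROVED BY A LINE; typed ≠ proved; NOT abc, NOT A-PS. It suffices (for the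
registered rung A1′ = `Summit.ABC.Harvest.SubexponentialSzpiro`, log|Δ_min(E)| ≪_ε N_E^ε for all
E/ℚ) to show X = X1 ∧ X2: X1 = Pasten's folklore Conjecture 1.14 («fudge factors are small»: Tam(E)
< K_ε·N_E^ε for every E/ℚ, the tree's named conjecture `SmallTamagawaConjecture`, OPEN) and X2 = the
TWIST DICTIONARY (X1 ⟹ A1′): Tate's c_p = ord_p(Δ_min) at split multiplicative primes (PROVED in
tree: `localTamagawaNumber_eq_ordMinimalDiscriminant_of_hasSplitMultiplicativeReductionAt`), one
global quadratic twist d with |d| ≤ 8·N² (CRT on square classes) turning every non-split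
multiplicative prime split and every potentially multiplicative additive prime multiplicative, and
the Kodaira–Néron bound ord_v(Δ_min) ≤ B at potentially good additive places; the ε-room absorbs the
polynomial conductor inflation N(E^(d)) ≤ 6912·(N·d)². X1 sits strictly between the registered
rungs: A-PS ⟹ X1 (de Weger–Hindry, Tam ≤ d(Δ)², the aside item) and X1 ⟹ A1′ (X2); neither converse
is known. bears_on: LADDER-ABC:A1′ (record rung) — it inserts the Tamagawa rung between A-PS and A1′
with both comparison glues typed; it does NOT move abc or A-PS.
Lean: `Literature.NumberTheory.EllipticCurves.SmallTamagawaConjecture ∧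
(Literature.NumberTheory.EllipticCurves.SmallTamagawaConjecture →
Summit.ABC.Harvest.SubexponentialSzpiro)`

## Assembly
Pure logic: the payoff X2 applied to X1 is the rung. The deciding theorem `closes (h₁ :
TamagawaTwistPayoff) (h₂ : SmallTamagawa) : Summit.ABC.Harvest.SubexponentialSzpiro := h₁ h₂`
concludes the registered A1′ closer (`--closes-target A1p`), not the summit Statement.

CLOSES_TARGET: closes rung ABC-A1' (PROPOSED) of ABC: Summit.ABC.Harvest.SubexponentialSzpiro (D-0061; not the summit Statement) — the deciding theorem of this route concludes that registered leaf instead of the Statement decl `ABC` (class rung: servable and labelled, never counted as concluding the summit Statement).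

Rationale: WHY THIS LINE. The dictionary imported is the BSD-side one: Néron component groups ↔ Szpiro
exponents. At a split multiplicative prime the local Tamagawa number IS the discriminant exponent
(Tate; Silverman ATAEC IV.9.2(d)), at every other place it is ≤ 4 (Kodaira–Néron), and quadratic
twisting (conductor cost ≤ d², d ≤ 8N²) converts every multiplicative or potentially multiplicative
place into a split multiplicative one without changing −ord_p(j); so Conj 1.14 for all E/ℚ (twists
included) controls Σ_p n_p log p ≤ (ω(N) + Tam(E) + Tam(E^(d)) + 6ω(N) + B·ω(N))·log N. Pasten
states the implication without proof (JNT 254 (2024) = arXiv:1705.09251, p. 8 after Thm 1.15: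
«Conjecture 1.14 is not a mild conjecture; it implies … log Δ_E ≪_ε N_E^ε, which is currently an
open problem» [corpus:paper:arxiv-1705.09251 p0008]); the tree's `SubexponentialSzpiro` docstring
records it as CLAIMED-IN-PRINT, not proved, and the harvest glue ledger (G-01…G-29) has no Conj 1.14
⟹ A1′ row. X1 has its OWN partial-result ladder by a non-Baker, non-modular-degree engine: Tam(E) <
K·N^{11/2+ε} for semistable E (Pasten Thm 1.15, tree `pasten_thm_1_15_semistable`, via
Ribet–Takahashi ratios of Shimura-curve degrees). What the line does that prior routes do not:
RibetTakahashiSplit carries the valuation-product form of Conj 1.14 on Frey/semistable CLASSES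
toward abc; this line carries the all-E Tamagawa form to the all-E rung A1′ through the twist
dictionary and places it below A-PS. Honest ceiling (see Barriers): the ratio engine floors at
Tamagawa exponent ≈ 2, so X1 (exponent 0⁺) is beyond every engine in hand — a FRONTIER-type line
whose theorem content is X2 and the aside, not X1.

RANKED CRUXES. #2 SmallTamagawa (crux) — Pasten's Conjecture 1.14 (folklore «fudge factors are
small»): for every ε > 0 there is K_ε with Tam(E) < K_ε·N_E^ε for every elliptic curve E/ℚ — the
tree's named conjecture, by name. [difficulty: open-problem] (why it might fail: Only if Szpiro
fails badly (Szpiro ⟹ it via Tam ≤ d(Δ)²); no engine reaches exponent < 2 (Pasten's ratio identity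
has ‖f‖² ≍ N sharp and a generic integrality floor), so it is un-attackable today, and K_ε-free data
cannot refute it.) [PastenShimura2024, arXiv:1705.09251, doi:10.1093/qmathj/49.1.105]
#3 TamagawaTwistPayoff (crux) — The twist dictionary: Conjecture 1.14 for all E/ℚ implies
sub-exponential Szpiro for all E/ℚ (split multiplicative c_p = ord_p Δ_min; one quadratic twist d,
|d| ≤ 8N², making all multiplicative and potentially multiplicative places split multiplicative;
ord_v Δ_min bounded at potentially good places; conductor of the twist ≤ 6912(Nd)²). [difficulty: L]
(why it might fail: The potentially-multiplicative twist step is in tree only for v ∤ 6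
(`exists_hasMultiplicativeReductionAt_quadraticTwist`); at p = 2, 3 with −ord_p(j) huge the
twist-to-split step and the bound on ord_p(Δ_min) − (−ord_p j) must be supplied, else n_2, n_3
escape.) [PastenShimura2024, SilvermanATAEC1994, SilvermanAEC2009, Matsuno2009]
#9 SmallTamagawaOfPolySzpiro (support) — Placement below A-PS (de Weger–Hindry): polynomial Szpiro
implies Conjecture 1.14, via c_p ≤ ord_p(Δ_min) at multiplicative p, c_v ≤ 4 at additive v, and n ≤
p^{nε} for p ≥ e^{1/(eε)}; ASIDE (banked context, not in the cone of `closes`). [difficulty: M]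
[doi:10.1093/qmathj/49.1.105, PastenShimura2024]
#9 SmallTamagawaNoSplit (support) — BC5 plan-only rung and separating witness: Conjecture 1.14 on
the class of curves with NO split multiplicative place is the Kodaira–Néron table (c_v ≤ 2
non-split, ≤ 4 additive, so Tam ≤ 4^{ω(N)} ≪_ε N^ε) — a regime where X1 is elementary while A1′ is
open (n_p at non-split primes is unconstrained); ASIDE. [difficulty: M] [SilvermanATAEC1994,
PastenShimura2024]

TWO-LAYER PLAN. TamagawaTwistPayoff ⇐ TwistSupply → TwistLocal → PotGoodBound → TamagawaTwistPayoff: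
TwistSupply (CRT: a global d ≠ 0, |d| ≤ 8N², with prescribed classes in ℚ_p^×/ℚ_p^{×2} at every p |
N), TwistLocal (reduction type and ord_p Δ_min of E^(d) at p | N: unit non-square twist swaps
split/non-split at multiplicative p — tree `hasSplitMultiplicativeReduction_quadraticTwist_iff`;
ramified twist at potentially multiplicative p gives I_n with n = −ord_p j — tree
`exists_hasMultiplicativeReductionAt_quadraticTwist` for v ∤ 6, p | 6 to supply), PotGoodBound
(ord_v Δ_min ≤ B at potentially good additive v; p ≥ 5: Néron table via
`ordMinimalDiscriminant_eq_numComponentsAt_add_one`, B = 10).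

KILL CRITERIA. A refutation of SmallTamagawa (a family with Tam(E) ≥ N^δ) closes the route
`refuted:SmallTamagawa` — and would refute Szpiro's conjecture with it. A refutation of
TamagawaTwistPayoff as typed (e.g. a p = 2 potentially multiplicative obstruction to twisting into
split reduction with controlled ord_2 Δ_min) forces a restatement with an explicit 2-adic correction
term; if the correction is unbounded the line is dead. If the desk lands Conj 1.14 ⟹ A1′ as a G-row
first, the payoff item closes by citation and the route reduces to the record «X1 is a rung between
A-PS and A1′».

NOT DECOMPOSED YET. The three children of the payoff (TwistSupply, TwistLocal, PotGoodBound) are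
layer-2 and not filed; the p | 6 potentially multiplicative twist lemma is the one piece not located
in the tree. No attack on X1 is filed: the only engine (Pasten's Shimura-degree ratios) is recorded
with its floor under Barriers.

CHEAPEST FALSIFIER. For the key lemma X2: LMFDB/ecdata check of the dictionary on curves with
additive potentially multiplicative reduction at 2 (Kodaira I_n^*at 2, e.g. 48a-type families): does
some quadratic twist by d ∈ {−1, ±2, ±3, ±6} have split multiplicative reduction at 2 with c_2 =
−ord_2(j)? (instrument row: ENG «twist-to-split at 2», a finite table). For X1: the calibration row
«max_{N ≤ 5·10⁵} log Tam(E)/log N over Cremona allbsd» (expected ≈ 0.5–0.7 at small N, decreasing) —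
K_ε-free data can only calibrate, not refute. Run by me: none (no new kit job this generation).

NUMBERS. Pasten Thm 1.15: Tam(E) < K_{ε}·N^{11/2+ε} for semistable E (tree
`pasten_thm_1_15_semistable`); with ≥ 3 + 11/ε bad places 8/3 + ε (valuation form, `thm_16_5`).
Anatomy of 11/3 per admissible D (arXiv p. 49, proof of Thm 16.1): 1 [‖f‖² ≤ N log N] + 5/3
[integrality lower bound for the quaternionic transfer] + 1 [log D + log M]. Conductor exponents:
f_2 ≤ 8, f_3 ≤ 5, f_p ≤ 2 (p ≥ 5), so N(E^(d)) ≤ 2^8·3^5·∏_{p | Nd, p ≥ 5} p² ≤ 6912·(Nd)².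
Murty–Pasten: log|Δ_min| ≤ (κ + o(1)) N log N (α = 1 record for all E).

DEFINITION REQUESTS. None. Fact wanted (cite item, not filed tonight): «potentially multiplicative
reduction at v | 6 becomes multiplicative after a quadratic twist, with ord_v(Δ_min of the twist) =
−ord_v(j)» (Silverman ATAEC V.5.3 / Lemma V.5.2, any residue characteristic).

Novelty: Searches (2026-08-28): lit search --hybrid "Tamagawa number bounded by power of conductor implies
Szpiro discriminant bound quadratic twist" (6 docs: Evertse–Győry 2015, Delbourgo 2008, Coates 1999,
Cornell–Silverman–Stevens 1997 — none with the implication); lit vsearch «product of Tamagawa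
numbers ≤ N^ε implies subexponential discriminant bound» (Silverman AEC pp. 180/222, CSS 1997 —
background only); lit galaxy search "fudge factor|Tamagawa numbers of quadratic twists|Tamagawa
number conjecture small" --star all (24 rows, all noise: no hits); tree: rg SmallTamagawa /
tamagawaProduct over Summits/ABC/Harvest (A1′ docstring: CLAIMED-IN-PRINT; HARVEST.md G-01…G-29: no
Conj 1.14 ⟹ A1′ glue); ledger negatives --problem ABC (1205, 1689: unrelated).
Nearest prior art found: [corpus:paper:arxiv-1705.09251 p0008 L86–90] Pasten 2024, the unproved
remark «Conj 1.14 implies log Δ_E ≪_ε N_E^ε»; [corpus:paper:doi-10-1093-qmathj-49-1-105] de Weger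
1998 (Tam vs d(Δ)², the converse direction); in tree: route RibetTakahashiSplit cruxes
`ManyPrimeValuationProduct*` (valuation-product form on Frey/semistable classes, toward abc) and
`Literature…SmallTamagawaConjecture` (typed, no glue).
Delta: types Pasten's unproved remark as a kernel target with the explicit twist dictionary (one
global twist of size ≤ 8N², Tate's c_p = ord_p Δ_min, Kodaira–Néron bounds) and places Conj 1.14 as
a rung strictly between A-PS and A1′ with both comparison glues — no listed route carries the all-E
Tamagawa form  [refs: paper:arxiv-1705.09251, paper:doi-10-1093-qmathj-49-1-105]

Barriers (technique_class: tamagawa-dictionary, quadratic-twist, kodaira-neron): - technique_class: tamagawa-dictionary, quadratic-twist, kodaira-neron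
- Literature.Barriers.ABC.EpsilonCannotBeDropped: consistent — Masser's curves with Szpiro ratio > 6
− ε have Tam ≤ d(Δ)² = N^{o(1)}; X1 asks only N^ε.
- Literature.Barriers.ABC.BakerMethodBounds (Baker/LFL class; Stewart–Yu exponent 1/3): outside — no
linear form in logarithms anywhere in the line; X2 is local (Tate curve + Kodaira–Néron) and X1's
engine is Shimura-degree ratios.
- B-RATIO×MINIMUM (this seat's barrier note, not catalogued): X1 as typed requires beating the
ratio-method floor (Tamagawa exponent ≈ 2 from Pasten's identity (16.1) with ‖f‖² ≍ N sharp)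
head-on; the line does NOT claim to — X1 carries no prover and is declared FRONTIER; the bet is only
that the dictionary X2 and the placement are worth having in the kernel.
- B-INT×POS / B-LFL×DIVFIELD / B-CONG×HECKEDEG (seat notes): not engaged — no period, no unit
equation, no congruence.
- Negatives index: stmt-ABC-1205 (BelyiSqueeze) and stmt-ABC-1689 (GlobalQuasiLogDerivative) are not
restated; empty otherwise at filing.

History (route lifecycle, newest last):
- 2026-08-28T00:30:36Z · rev 1: restated SmallTamagawaOfPolySzpiro (stmt-ABC-24115) — birth fix: aside SmallTamagawaOfPolySzpiro reached the @[conjecture] leaf Summit.ABC.PolySzpiroRat (undeclared-conjecture, route not staffable); restated with t (planner-abc-idea-1-g3-0)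
- 2026-08-28T00:32:15Z · rev 2: dropped Assembly — birth fix bc6: the optional Assembly item ((X1→S)→X1→S, a tautology) is not in the cone of the deciding theorem closes and was auto-cruxed by the gate; closes ( (planner-abc-idea-1-g3-0)
- 2026-08-28T00:38:06Z · rev 3: restated SmallTamagawa (stmt-ABC-24113) — conjecture migration: SmallTamagawaConjecture is now Summit.ABC.ABC.SmallTamagawaConjecture (gate:conjectures)
- 2026-08-28T00:38:06Z · rev 3: restated TamagawaTwistPayoff (stmt-ABC-24114) — conjecture migration: SmallTamagawaConjecture is now Summit.ABC.ABC.SmallTamagawaConjecture (gate:conjectures)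
- 2026-08-28T00:38:07Z · rev 3: restated SmallTamagawaOfPolySzpiro (stmt-ABC-24130) — conjecture migration: SmallTamagawaConjecture is now Summit.ABC.ABC.SmallTamagawaConjecture (gate:conjectures)

sub-problem: ABC · status: draft · opened planner-abc-idea-1-g3-0 2026-08-28T00:29:07Z · rev 2 · ledger route-ABC-TamagawaTwistDictionary
GENERATED by the gate from the ledger (D-0016/17). Provers cite these decls: `theorem foo : Summit.ABC.ABC.Theses.TamagawaTwistDictionary.<Decl> := …` in Summits/ABC/ABC/Theorems/<Name>.lean.
-/

namespace Summit.ABC.ABC.Theses.TamagawaTwistDictionary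

open scoped BigOperators Topology Manifold Classical MeasureTheory ProbabilityTheory Matrix InnerProductSpace ComplexConjugate ContinuousMap
open Filter Set Function TopologicalSpace MeasureTheory

attribute [summit_statement] _root_.ABC
attribute [summit_statement] _root_.Summit.ABC.Harvest.SubexponentialSzpiro

open Literature.Abc

/-- item stmt-ABC-24113 · crux · rank 2 · open · by planner
why it might fail: Only if Szpiro fails badly (Szpiro ⟹ it via Tam ≤ d(Δ)²); no engine reaches exponent < 2 (Pasten's ratio identity has ‖f‖² ≍ N sharp and a generic integrality floor), so it is un-attackable today, and K_ε-free data cannot refute it.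
sources: PastenShimura2024, arXiv:1705.09251, doi:10.1093/qmathj/49.1.105
[crux] Pasten's Conjecture 1.14 (folklore «fudge factors are small»): for every ε > 0 there is K_ε
with Tam(E) < K_ε·N_E^ε for every elliptic curve E/ℚ — the tree's named conjecture, by name.
[difficulty: open-problem] -/
@[route_item "route-ABC-TamagawaTwistDictionary", crux]
def SmallTamagawa : Prop :=
  Literature.NumberTheory.EllipticCurves.SmallTamagawaConjecture

/-- item stmt-ABC-24114 · crux · rank 3 · closed · proved by Summit.ABC.ABC.Theorems.tamagawaTwistPayoff_proof (prover) · by planner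
why it might fail: The potentially-multiplicative twist step is in tree only for v ∤ 6 (`exists_hasMultiplicativeReductionAt_quadraticTwist`); at p = 2, 3 with −ord_p(j) huge the twist-to-split step and the bound on ord_p(Δ_min) − (−ord_p j) must be supplied, else n_2, n_3 escape.
sources: PastenShimura2024, SilvermanATAEC1994, SilvermanAEC2009, Matsuno2009
[crux] The twist dictionary: Conjecture 1.14 for all E/ℚ implies sub-exponential Szpiro for all E/ℚ
(split multiplicative c_p = ord_p Δ_min; one quadratic twist d, |d| ≤ 8N², making all multiplicative
and potentially multiplicative places split multiplicative; ord_v Δ_min bounded at potentially good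
places; conductor of the twist ≤ 6912(Nd)²). [difficulty: L] -/
@[route_item "route-ABC-TamagawaTwistDictionary", crux]
def TamagawaTwistPayoff : Prop :=
  Literature.NumberTheory.EllipticCurves.SmallTamagawaConjecture → Summit.ABC.Harvest.SubexponentialSzpiro

-- `TamagawaTwistPayoff` holds: proved by `Summit.ABC.ABC.Theorems.tamagawaTwistPayoff_proof` (its module imports this route file, so no `_holds` link can be stated here).

/-- item stmt-ABC-24116 · aside · rank 9 · open · by planner
sources: SilvermanATAEC1994, PastenShimura2024
[support] BC5 plan-only rung and separating witness: Conjecture 1.14 on the class of curves with NO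
split multiplicative place is the Kodaira–Néron table (c_v ≤ 2 non-split, ≤ 4 additive, so Tam ≤
4^{ω(N)} ≪_ε N^ε) — a regime where X1 is elementary while A1′ is open (n_p at non-split primes is
unconstrained); ASIDE. [difficulty: M] -/
@[route_item "route-ABC-TamagawaTwistDictionary"]
def SmallTamagawaNoSplit : Prop :=
  ∀ ε : ℝ, 0 < ε → ∃ K : ℝ, ∀ (W : WeierstrassCurve ℚ) [W.IsElliptic], (∀ v : IsDedekindDomain.HeightOneSpectrum ℤ, ¬ W.HasSplitMultiplicativeReductionAt v) → (W.tamagawaProduct : ℝ) < K * (W.conductorNorm ℤ : ℝ) ^ ε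

-- earlier SmallTamagawaOfPolySzpiro (stmt-ABC-24115, replaced 2026-08-28T00:30:36Z -> stmt-ABC-24130): retired by None — Summit.ABC.PolySzpiroRat → Literature.NumberTheory.EllipticCurves.SmallTamagawaConjecture
/-- item stmt-ABC-24130 · aside · rank 9 · open · by planner
sources: doi:10.1093/qmathj/49.1.105, PastenShimura2024
ASIDE (banked placement, not in the cone of closes): polynomial Szpiro (the body of the A-PS rung
`Summit.ABC.PolySzpiroRat`, unfolded so the route does not depend on an undeclared conjecture
constant) implies Pasten Conj 1.14 via c_p ≤ ord_p Δ_min at multiplicative p, c_v ≤ 4 at additive v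
(de Weger–Hindry Tam ≤ d(Δ)²). -/
@[route_item "route-ABC-TamagawaTwistDictionary"]
def SmallTamagawaOfPolySzpiro : Prop :=
  (∃ K C : ℝ, ∀ (W : WeierstrassCurve ℚ) [W.IsElliptic], Real.log (W.minimalDiscriminantNorm ℤ : ℝ) ≤ K * Real.log (W.conductorNorm ℤ : ℝ) + C) → Literature.NumberTheory.EllipticCurves.SmallTamagawaConjecture

/-! D-0027 §2.1 — DECIDING THEOREM (planner-authored via `route open/edit --closes-file`; by planner-abc-idea-1-g3-0 2026-08-28T00:29:07Z):
its hypotheses are this route's items and its conclusion the registered leaf `Summit.ABC.Harvest.SubexponentialSzpiro` (rung ABC-A1' (PROPOSED), D-0061) (glue_lint), and it elaborates with this file. -/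

@[closes "route-ABC-TamagawaTwistDictionary"] theorem closes (h₁ : TamagawaTwistPayoff) (h₂ : SmallTamagawa) :
    Summit.ABC.Harvest.SubexponentialSzpiro := h₁ h₂

end Summit.ABC.ABC.Theses.TamagawaTwistDictionary
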